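import Summits.QuantumAdvantage.AdviceFreeQNC0.AffBells23JuntaDecorrelation
import Summits.QuantumAdvantage.AdviceFreeQNC0.AffBells22SpanPhi
import HarnessLib

/-!
# Sketch23 §4 `VarianceDecorrelationBound`, proved (ask P-23d), with Parseval on `𝔽₃^m`

* `parseval_fhat` — `Σ_t ‖ĝ(t)‖² = 3^{−m} Σ_y ‖g(y)‖²` for the tree's Fourier coefficients `AffBells22.fhat`
  (orthogonality `TwoModuli.sum_stdAddChar_dot_eq_ite`);
* `varianceDecorrelationBound : AffBells23.VarianceDecorrelationBound` — the Cauchy–Schwarz/Parseval step behind the variance form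
  of the frame-averaging cross term (ROUND-22 §2.1, FA-Var): `|Σ_{t ≠ 0} ĝ_t H_t| ≤ (Σ_{t ≠ 0} |H_t|²)^{1/2}` when `E_y|g|² ≤ 1`
  (the statement's phase `(ω^{Σ_l (t_l y_l).val})⁻¹` is `χ₃(−⟨t,y⟩)`, `TwoModuli.cexp_two_pi_I_div_three_pow`, so the coefficient is
  literally `fhat m g t`).

Separation NOT moved.
-/

noncomputable section

open Classical

namespace Summit.QuantumAdvantage.AdviceFreeQNC0

open Finset
open Literature.Computability.QuantumComplexity Literature.Computability.QuantumComplexity.RingHLF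
open Literature.Computability.MetaComplexity Literature.Computability.MetaComplexity.Smolensky
open F4 TubePlanProof AffBells22

namespace AffBells23

variable {m : ℕ}

/-! ## Parseval on `𝔽₃^m` for the tree's Fourier coefficients `AffBells22.fhat` -/

/-- `conj χ₃(a) = χ₃(−a)`. -/
theorem conj_stdAddChar_three (a : ZMod 3) :
    (starRingEnd ℂ) (ZMod.stdAddChar a : ℂ) = (ZMod.stdAddChar (-a) : ℂ) := by
  rw [ZMod.stdAddChar_apply, ZMod.stdAddChar_apply, AddChar.map_neg_eq_inv, Circle.coe_inv_eq_conj]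

/-- **Parseval**: `Σ_t ‖ĝ(t)‖² = 3^{−m} Σ_y ‖g(y)‖²` (`ĝ = AffBells22.fhat m g`). -/
theorem parseval_fhat (g : (Fin m → ZMod 3) → ℂ) :
    ∑ t : Fin m → ZMod 3, ‖fhat m g t‖ ^ 2 = ((3 : ℝ) ^ m)⁻¹ * ∑ y : Fin m → ZMod 3, ‖g y‖ ^ 2 := by
  -- the unnormalised sums
  set A : (Fin m → ZMod 3) → ℂ := fun t =>
    ∑ y : Fin m → ZMod 3, g y * (ZMod.stdAddChar (-(∑ i : Fin m, t i * y i)) : ℂ) with hA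
  have hfhat : ∀ t, fhat m g t = ((3 : ℂ) ^ m)⁻¹ * A t := fun t => rfl
  -- `Σ_t A t · conj (A t) = 3^m Σ_y ‖g y‖²` in `ℂ`
  have hconjA : ∀ t, (starRingEnd ℂ) (A t)
      = ∑ y : Fin m → ZMod 3, (starRingEnd ℂ) (g y) * (ZMod.stdAddChar (∑ i : Fin m, t i * y i) : ℂ) := by
    intro t
    simp only [hA, map_sum, map_mul, conj_stdAddChar_three, neg_neg]
  have hprod : ∀ t, A t * (starRingEnd ℂ) (A t)
      = ∑ y : Fin m → ZMod 3, ∑ y' : Fin m → ZMod 3,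
          g y * (starRingEnd ℂ) (g y') * (ZMod.stdAddChar (∑ i : Fin m, t i * (y' - y) i) : ℂ) := by
    intro t
    rw [hconjA, sum_mul_sum]
    refine sum_congr rfl fun y _ => sum_congr rfl fun y' _ => ?_
    have : (ZMod.stdAddChar (-(∑ i : Fin m, t i * y i)) : ℂ) * (ZMod.stdAddChar (∑ i : Fin m, t i * y' i) : ℂ)
        = (ZMod.stdAddChar (∑ i : Fin m, t i * (y' - y) i) : ℂ) := by
      rw [← AddChar.map_add_eq_mul]
      congr 1
      rw [← sum_neg_distrib, ← sum_add_distrib]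
      exact sum_congr rfl fun i _ => by rw [Pi.sub_apply]; ring
    rw [← this]; ring
  have hortho : ∀ y y' : Fin m → ZMod 3,
      ∑ t : Fin m → ZMod 3, (ZMod.stdAddChar (∑ i : Fin m, t i * (y' - y) i) : ℂ) = if y' = y then (3 : ℂ) ^ m else 0 := by
    intro y y'
    rw [TwoModuli.sum_stdAddChar_dot_eq_ite (y' - y)]
    by_cases h : y' = y
    · rw [if_pos (sub_eq_zero.mpr h), if_pos h]; push_cast; rfl
    · rw [if_neg (fun h' => h (sub_eq_zero.mp h')), if_neg h]
  have hS : ∑ t : Fin m → ZMod 3, A t * (starRingEnd ℂ) (A t)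
      = (3 : ℂ) ^ m * ∑ y : Fin m → ZMod 3, ((‖g y‖ : ℂ)) ^ 2 := by
    simp_rw [hprod]
    rw [sum_comm, mul_sum]
    refine sum_congr rfl fun y _ => ?_
    rw [sum_comm]
    simp_rw [← mul_sum, hortho, mul_ite, mul_zero]
    simp only [Finset.sum_ite_eq', Finset.mem_univ, if_true]
    rw [Complex.mul_conj']
    ring
  -- pass to real numbers
  have hreal : ((∑ t : Fin m → ZMod 3, ‖fhat m g t‖ ^ 2 : ℝ) : ℂ)
      = ((((3 : ℝ) ^ m)⁻¹ * ∑ y : Fin m → ZMod 3, ‖g y‖ ^ 2 : ℝ) : ℂ) := by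
    push_cast
    have h3 : ((3 : ℂ) ^ m) ≠ 0 := pow_ne_zero _ (by norm_num)
    have hterm : ∀ t, ((‖fhat m g t‖ : ℂ)) ^ 2 = ((3 : ℂ) ^ m)⁻¹ * ((3 : ℂ) ^ m)⁻¹ * (A t * (starRingEnd ℂ) (A t)) := by
      intro t
      rw [← Complex.mul_conj', hfhat, map_mul, map_inv₀, map_pow]
      simp only [map_ofNat]
      ring
    simp_rw [hterm]
    rw [← mul_sum, hS]
    field_simp
  exact_mod_cast hreal

/-- **`VarianceDecorrelationBound` PROVED** (Cauchy–Schwarz over `t ≠ 0` + Parseval `Σ_t |ĝ_t|² = 3^{−m} Σ_y |g(y)|² ≤ 1`). -/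
theorem varianceDecorrelationBound : VarianceDecorrelationBound := by
  intro m g H hg
  -- the coefficient is the tree's `fhat`
  have hphase : ∀ t y : Fin m → ZMod 3,
      (Complex.exp (2 * Real.pi * Complex.I / 3) ^ (∑ l, (t l * y l).val))⁻¹
        = (ZMod.stdAddChar (-(∑ i : Fin m, t i * y i)) : ℂ) := by
    intro t y
    rw [TwoModuli.cexp_two_pi_I_div_three_pow, Nat.cast_sum, AddChar.map_neg_eq_inv]
    congr 2
    exact sum_congr rfl fun l _ => ZMod.natCast_zmod_val _
  have hcoef : ∀ t : Fin m → ZMod 3,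
      ((3 : ℂ) ^ m)⁻¹ * (∑ y : Fin m → ZMod 3, g y *
          (Complex.exp (2 * Real.pi * Complex.I / 3) ^ (∑ l, (t l * y l).val))⁻¹) * H t
        = fhat m g t * H t := by
    intro t
    unfold fhat
    congr 2
    exact sum_congr rfl fun y _ => by rw [hphase]
  rw [sum_congr rfl fun t _ => hcoef t]
  set s := (univ : Finset (Fin m → ZMod 3)).filter fun t => t ≠ 0 with hs
  -- Parseval ⇒ Σ_{t ∈ s} ‖ĝ t‖² ≤ 1
  have h3pos : (0 : ℝ) < (3 : ℝ) ^ m := by positivity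
  have hpar : ∑ t ∈ s, ‖fhat m g t‖ ^ 2 ≤ 1 := by
    calc ∑ t ∈ s, ‖fhat m g t‖ ^ 2 ≤ ∑ t : Fin m → ZMod 3, ‖fhat m g t‖ ^ 2 :=
          sum_le_sum_of_subset_of_nonneg (filter_subset _ _) (fun t _ _ => by positivity)
      _ = ((3 : ℝ) ^ m)⁻¹ * ∑ y : Fin m → ZMod 3, ‖g y‖ ^ 2 := parseval_fhat g
      _ ≤ ((3 : ℝ) ^ m)⁻¹ * (3 : ℝ) ^ m := mul_le_mul_of_nonneg_left hg (by positivity)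
      _ = 1 := inv_mul_cancel₀ h3pos.ne'
  -- Cauchy–Schwarz
  have hCS := sum_mul_sq_le_sq_mul_sq s (fun t => ‖fhat m g t‖) (fun t => ‖H t‖)
  have hnn : 0 ≤ ∑ t ∈ s, ‖fhat m g t‖ * ‖H t‖ := sum_nonneg fun t _ => by positivity
  have hH0 : 0 ≤ ∑ t ∈ s, ‖H t‖ ^ 2 := sum_nonneg fun t _ => by positivity
  calc ‖∑ t ∈ s, fhat m g t * H t‖ ≤ ∑ t ∈ s, ‖fhat m g t * H t‖ := norm_sum_le _ _
    _ = ∑ t ∈ s, ‖fhat m g t‖ * ‖H t‖ := sum_congr rfl fun t _ => norm_mul _ _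
    _ ≤ Real.sqrt ((∑ t ∈ s, ‖fhat m g t‖ ^ 2) * ∑ t ∈ s, ‖H t‖ ^ 2) := Real.le_sqrt_of_sq_le hCS
    _ ≤ Real.sqrt (1 * ∑ t ∈ s, ‖H t‖ ^ 2) := Real.sqrt_le_sqrt (mul_le_mul_of_nonneg_right hpar hH0)
    _ = Real.sqrt (∑ t ∈ s, ‖H t‖ ^ 2) := by rw [one_mul]

end AffBells23

end Summit.QuantumAdvantage.AdviceFreeQNC0
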